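import Summits.BirchSwinnertonDyer.Rank1Residual.X9.TransportPairsB
import Summits.BirchSwinnertonDyer.Rank1Residual.X9.S4DescentPairsZimmertD
import HarnessLib

/-!
# Class X9, `p = 5`: transport part D — `199988e1` from its SECOND kernel-certified partner `8092e1` (no `BSDp` binder), and
# Mazur's main conjecture WITH `μ = 0` at the pair `(199988e1, 5)` (the N3 typed target inhabited at the last X9-only open cell)

HONEST FRAMING (cell `b2b-bsdres-*`, verbatim): the cell deletes COMBINATION-SHAPED residual classes of
the rank-≤1 BSD formula from PUBLISHED theorems only and TYPES the construction-shaped remainder; this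
is not "finishing BSD". Class X9 stays TYPED at class level; everything here is PER PAIR; no lane verdict
is changed; no named fact; nothing is booked by this unit (the lane books, the referee rules).
Unit `b2b-bsdres-x9`, gen 15; companion of `X9/TransportPairs{,B,C}.lean` and `X9/S4DescentPairsZimmertD.lean`.

* `bsdp_t199988e1'` — the record `bsdp_t199988e1_of_bsdp_s8092e1` (part B) with its binder `hbsdA : BSDp 8092e1 5`
  DISCHARGED by the kernel theorem `X9.bsdp_s8092e1` (part D: exact `5`-descent, run + verifier kit j127696, class group
  Zimmert-CERTIFIED kit j127706). So `199988e1 @ 5` now has TWO kernel chains with no `BSDp` hypothesis, through two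
  different partners (`484364c1`: `bsdp_t199988e1`; `8092e1`: this), with INDEPENDENT C1 certificates (Kraus–Oesterlé bounds
  `22 362 479` resp. `425 951`; the second one certified by five engine runs over gens 10 and 15) and independent C3 certificates.
* `mazurMainConjecture_t199988e1` — from `bsdp_t199988e1` and ONE more finite certificate, `μ(𝓛₅(E)) = 0` for `E = 199988e1`
  itself (gen 9 `MU-ALL.tsv`: engines B and C, `λ = 2`), gen 5's `mazurMainConjecture_with_mu_zero_of_bsdp` gives Mazur's
  cyclotomic main conjecture for `(E, 5)` INTEGRALLY with `μ = 0` at every cyclotomic datum — i.e. the BODY of the class's typed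
  input `IntegralMainConjectureOnClassX9` (the N3 E1 target of `class-closure/N3/STATEMENT.md`) and Greenberg's Conjecture 1.11,
  at the pair `(199988e1, 5)`: a `5S4`-image curve, where neither Kato's Thm. 17.4 (3) nor BCS 2025 Thm. 1.1.2 (b) applies
  (`ClassX9.not_bigIm`). Per pair; the class-level statement stays OPEN.

References: Greenberg–Vatsal 2000 Thm. (1.4); BCS 2025 Thm. 1.1.2 (a); Kraus–Oesterlé 1992 Prop. 4; Greenberg LNM 1716 Thm. 4.1
and Conj. 1.11; Mazur 1978 Prop. 6.3 (1); Miller 2011 Def. 1.1; Cremona's tables.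
-/

set_option autoImplicit false

noncomputable section

open scoped Classical MatrixGroups ModularForm

open CongruenceSubgroup WeierstrassCurve Literature.NumberTheory.EllipticCurves
  Literature.NumberTheory.EllipticCurves.ModularForms Literature.NumberTheory.EllipticCurves.Rank1Residual
  Literature.NumberTheory.EllipticCurves.Rank1Residual.Typed
  Literature.NumberTheory.EllipticCurves.Rank1Residual.X11RankOneCertificates
  Summit.BirchSwinnertonDyer.BirchSwinnertonDyer.Rank1Residual.IntModel
  Summit.BirchSwinnertonDyer.BirchSwinnertonDyer.Rank1Residual.X11RankOne
  Summit.BirchSwinnertonDyer.Rank1Residual.X11b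

namespace Summit.BirchSwinnertonDyer.Rank1Residual.X9

/-- **`BSD(E,5)` for `199988e1` through the partner `8092e1`, NO `BSDp` binder** (`N = 199988 = 2²·17²·173`, `r_an = 0`,
`#Ш_an = 25`; partner `N_A = 8092 = 2²·7·17²`, `r_an(A) = 1`, `#Ш_an(A) = 1`): the part-B record
`bsdp_t199988e1_of_bsdp_s8092e1` with `hbsdA` discharged by `bsdp_s8092e1` (exact `5`-descent `#Sel⁵(A) = 5`, kit j127696,
verifier VERIFIED; class group of the degree-24 field Zimmert-CERTIFIED, kit j127706). Binders: PUBLISHED `hKO … hGZK`; FINITE: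
`r_an(E) = 0`; `r_an(A) ≤ 1`, `#Ш_an(A) = q` with `ord₅ q = 0` (Heegner CERT `D = −47`, `m = 18`), A's descent line `hSelA`;
C1 `hcong` (`B = 425 951`, `35 847` primes; numpy/PARI/ENGINE D gen 10 j085527/j087181/j093230 + PARI/ENGINE D gen 15 j127638);
C2 `hcertA` (gen 9 MU-ALL, two engines); C3 `hSchA` (PARI `ellpadicheight` `v₅(f − s₂g) = 1` + Mazur–Tate σ `v₅(h) = 0`,
gens 10/15). Instance binders discharged by `isElliptic_t199988e1` / `isGloballyMinimal_t199988e1` (part A) and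
`isElliptic_s8092e1` / `isGloballyMinimal_s8092e1` (part B). Per pair; nothing booked.
[cite: GreenbergVatsal2000, Thm. (1.4) (arXiv p. 5)] [cite: KrausOesterle1992, Prop. 4] [cite: Miller2011LMS, Def. 1.1]
[cite: Cremona2006, Table 1 (Cremona labels 199988e1, 8092e1)] -/
theorem bsdp_t199988e1'
    (hKO : KrausOesterle1992.prop4_torsionIso_of_congruences)
    (hBCS : burungale_castella_skinner_charIdeal_eq_padicLFunction)
    (hGr : greenberg_charValue_rankZero) (h5 : realPeriodRat_eq_unit_mul_plusPeriod)
    (hGV : GreenbergVatsal2000.thm14_mainConjecture_transfer_of_torsionIso)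
    (hS : Schneider1985_order_charGenerator) (hPR : perrinRiou_rankOne_leadingTerms)
    (hmodP : nonempty_modularParametrizationData) (hmodL : hasEntireLFunction_rat)
    (hGZK : rank_eq_analyticRank_of_analyticRank_le_one)
    (W A : WeierstrassCurve ℚ) [W.IsElliptic] [W.IsGloballyMinimal] [A.IsElliptic] [A.IsGloballyMinimal]
    [Fact (Nat.Prime 5)]
    (hW : W = ⟨0, 0, 0, -41642588, -103238220075⟩) (hA : A = ⟨0, 0, 0, -4913, 2088025⟩)
    (hr : W.analyticRank = 0) (hrA : A.analyticRank ≤ 1)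
    {qA : ℚ} (hqA : shaAn A = (qA : ℂ)) (hvA : padicValRat 5 qA = 0)
    (hSelA : Nat.card (A.selmerGroup (5 : ℤ)) = 5 ^ A.analyticRank)
    (hSchA : A.analyticRank = 1 → ∀ Dh : PAdicHeightData A 5, Dh.IsCanonical → SchneiderConjecture Dh)
    (hcertA : ∀ [NeZero (A.conductorNorm ℤ)] (fA : CuspForm (Gamma0 (A.conductorNorm ℤ)) 2),
        IsNewformOf A fA → ∀ (ϖ : ℚ), (ϖ : ℝ) * A.realPeriodRat = plusPeriod fA →
      ∃ n : ℕ, ‖PowerSeries.coeff n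
        (PowerSeries.C (ϖ : ℚ_[5]) * padicLFunction fA (unitRoot A 5 : ℚ_[5]))‖ = 1)
    (hcong : ∀ (ℓ : ℕ) [Fact ℓ.Prime],
      6 * ℓ < KrausOesterle1992.gammaZeroIndex (KrausOesterle1992.modulus W A) →
      (padicValNat ℓ (W.conductorNorm ℤ * A.conductorNorm ℤ) = 0 →
          (5 : ℤ) ∣ W.frobeniusTrace ℓ - A.frobeniusTrace ℓ) ∧
        (padicValNat ℓ (W.conductorNorm ℤ * A.conductorNorm ℤ) = 1 →
          (5 : ℤ) ∣ W.frobeniusTrace ℓ * A.frobeniusTrace ℓ - (ℓ + 1))) :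
    BSDp W 5 :=
  bsdp_t199988e1_of_bsdp_s8092e1 hKO hBCS hGr h5 hGV hS hPR hmodP hmodL hGZK W A hW hA hr hrA
    (bsdp_s8092e1 hGZK A hA hrA hqA hvA hSelA) hSchA hcertA hcong

/-- **Mazur's cyclotomic main conjecture for `(199988e1, 5)`, INTEGRALLY, WITH `μ = 0`** — the body of the class's typed input
`IntegralMainConjectureOnClassX9` / Greenberg's Conj. 1.11 at this pair (`ρ̄_{E,5}` of EXCEPTIONAL type `5S4`: no element `σ` with
`T/(σ−1)T ≅ ℤ₅`, so neither Kato 17.4 (3) nor BCS 2025 Thm. 1.1.2 (b) applies). From `bsdp_t199988e1` (part A: transport from the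
kernel-certified partner `484364c1`; its binders are repeated here verbatim) and ONE more finite certificate `hcert`: a `5`-adic unit
coefficient of `ϖ·L₅(f_E, α)` for `E` itself (gen 9 `MU-ALL.tsv`, engines B and C, `λ = 2`), through gen 5's
`mazurMainConjecture_with_mu_zero_of_bsdp` (BCS (a) gives `ι g = 5^k·L₅`; `BSD(E,5)` in rank `0` forces `k = 0`; the unit coefficient
gives `HasUnitContent g`, i.e. `μ(g) = 0`). Conclusion: for every cyclotomic `ℤ₅`-extension datum `(κ, γ)`, the newform `f` of `E` and
`ϖ` with `ϖ·Ω_E = Ω⁺_f`, every Selmer dual datum `D` is torsion with `char D = (g)`, `g` of unit content, `ι g = ϖ·L₅(f, α)`.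
Per pair; the class-level statement stays OPEN. [cite: GreenbergLNM1716, §1 Conj. 1.11 and Thm. 4.1 (p. 102)]
[cite: BurungaleCastellaSkinner2025, Thm. 1.1.2 (a) (p. 2 of arXiv:2405.00270v2)] [cite: GreenbergVatsal2000, Thm. (1.4) (arXiv p. 5)]
[cite: Cremona2006, Table 1 (Cremona labels 199988e1, 484364c1)] -/
theorem mazurMainConjecture_t199988e1
    (hKO : KrausOesterle1992.prop4_torsionIso_of_congruences)
    (hBCS : burungale_castella_skinner_charIdeal_eq_padicLFunction)
    (hGr : greenberg_charValue_rankZero) (h5 : realPeriodRat_eq_unit_mul_plusPeriod)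
    (hGV : GreenbergVatsal2000.thm14_mainConjecture_transfer_of_torsionIso)
    (hS : Schneider1985_order_charGenerator) (hPR : perrinRiou_rankOne_leadingTerms)
    (hmodP : nonempty_modularParametrizationData) (hmodL : hasEntireLFunction_rat)
    (hGZK : rank_eq_analyticRank_of_analyticRank_le_one)
    (W A : WeierstrassCurve ℚ) [W.IsElliptic] [W.IsGloballyMinimal] [A.IsElliptic] [A.IsGloballyMinimal]
    [Fact (Nat.Prime 5)]
    (hW : W = ⟨0, 0, 0, -41642588, -103238220075⟩) (hA : A = ⟨0, 0, 0, 35688032, 215988312756⟩)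
    (hr : W.analyticRank = 0) (hrA : A.analyticRank ≤ 1)
    {qA : ℚ} (hqA : shaAn A = (qA : ℂ)) (hvA : padicValRat 5 qA = 0)
    (hSelA : Nat.card (A.selmerGroup (5 : ℤ)) = 5 ^ A.analyticRank)
    (hSchA : A.analyticRank = 1 → ∀ Dh : PAdicHeightData A 5, Dh.IsCanonical → SchneiderConjecture Dh)
    (hcertA : ∀ [NeZero (A.conductorNorm ℤ)] (fA : CuspForm (Gamma0 (A.conductorNorm ℤ)) 2),
        IsNewformOf A fA → ∀ (ϖ : ℚ), (ϖ : ℝ) * A.realPeriodRat = plusPeriod fA →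
      ∃ n : ℕ, ‖PowerSeries.coeff n
        (PowerSeries.C (ϖ : ℚ_[5]) * padicLFunction fA (unitRoot A 5 : ℚ_[5]))‖ = 1)
    (hcong : ∀ (ℓ : ℕ) [Fact ℓ.Prime],
      6 * ℓ < KrausOesterle1992.gammaZeroIndex (KrausOesterle1992.modulus W A) →
      (padicValNat ℓ (W.conductorNorm ℤ * A.conductorNorm ℤ) = 0 →
          (5 : ℤ) ∣ W.frobeniusTrace ℓ - A.frobeniusTrace ℓ) ∧
        (padicValNat ℓ (W.conductorNorm ℤ * A.conductorNorm ℤ) = 1 →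
          (5 : ℤ) ∣ W.frobeniusTrace ℓ * A.frobeniusTrace ℓ - (ℓ + 1)))
    (hcert : ∀ [NeZero (W.conductorNorm ℤ)] (f : CuspForm (Gamma0 (W.conductorNorm ℤ)) 2),
        IsNewformOf W f → ∀ (ϖ : ℚ), (ϖ : ℝ) * W.realPeriodRat = plusPeriod f →
      ∃ n : ℕ, ‖PowerSeries.coeff n
        (PowerSeries.C (ϖ : ℚ_[5]) * padicLFunction f (unitRoot W 5 : ℚ_[5]))‖ = 1) :
    ∀ (κ : ZpExtension ℚ 5) (γ : Field.absoluteGaloisGroup ℚ),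
        κ.IsCyclotomic → κ.IsTopGenerator γ → IsCyclotomicVariable 5 γ →
      ∀ [NeZero (W.conductorNorm ℤ)] (f : CuspForm (Gamma0 (W.conductorNorm ℤ)) 2),
        IsNewformOf W f → ∀ (ϖ : ℚ), (ϖ : ℝ) * W.realPeriodRat = plusPeriod f →
      ∀ (D : W.SelmerDualData κ γ), D.IsTorsion ∧
        ∃ g : IwasawaAlgebra 5, D.charIdeal = Ideal.span {g} ∧
          GreenbergVatsal2000.HasUnitContent g ∧
          iwasawaToPowerSeries 5 g =
            PowerSeries.C (ϖ : ℚ_[5]) * padicLFunction f (unitRoot W 5 : ℚ_[5]) := by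
  have hbsd : BSDp W 5 := bsdp_t199988e1 hKO hBCS hGr h5 hGV hS hPR hmodP hmodL hGZK W A hW hA hr hrA
    hqA hvA hSelA hSchA hcertA hcong
  have hIW : integralModelInt W = ⟨0, 0, 0, -41642588, -103238220075⟩ :=
    integralModelInt_eq_of_map_eq _ (by rw [hW]; ext <;> simp [WeierstrassCurve.map])
  have hΔ : (⟨0, 0, 0, -41642588, -103238220075⟩ : WeierstrassCurve ℤ).Δ =
      discOf [0, 0, 0, -41642588, -103238220075] := intCurve_Δ 0 0 0 (-41642588) (-103238220075)
  have hgood : W.HasGoodReductionAtPrime 5 :=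
    hasGoodReductionAtPrime_of_not_dvd W 5 (by rw [minimalDiscriminantInt_eq hIW, hΔ]; decide +kernel)
  have hord : ¬ (5 : ℤ) ∣ W.frobeniusTrace 5 := by rw [frobeniusTrace_eq hIW card_t199988e1_5]; decide
  haveI : Fact (Nat.Prime 3) := ⟨by norm_num⟩
  have hnoroot : ∀ t : ℕ, t < (5 : ℕ) →
      ¬ ((5 : ℕ) : ℤ) ∣ (t : ℤ) ^ 2 - (((3 : ℕ) : ℤ) + 1 - (4 : ℕ)) * t + (3 : ℕ) := by
    decide
  have hirr : W.HasIrreducibleModPGaloisRep 5 := by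
    refine hasIrreducibleModPGaloisRep_of_intModel_of_noroot hIW 5 3 (by decide) (by rw [hΔ]; decide +kernel)
      card_t199988e1_3 (forall_zmod_of_forall_lt fun t ht h0 ↦ hnoroot t ht ?_)
    rw [← ZMod.intCast_zmod_eq_zero_iff_dvd]
    push_cast at h0 ⊢
    linear_combination h0
  exact mazurMainConjecture_with_mu_zero_of_bsdp hBCS hGr h5 hmodL hGZK W 5 (by norm_num) hgood hord hirr hr
    hbsd hcert

end Summit.BirchSwinnertonDyer.Rank1Residual.X9

end
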